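import Summits.AnomalousDissipation.AnomalousDissipation.Theorems.SolenoidalFractalHomogenisationRealisedQuasiStaticCellLawUpperSomeSlotBounds
import Summits.AnomalousDissipation.AnomalousDissipation.Theorems.SolenoidalFractalHomogenisationRealisedQuasiStaticCellLawUpperSomeSlotLaw
import Summits.AnomalousDissipation.AnomalousDissipation.Theorems.SolenoidalFractalHomogenisationRealisedQuasiStaticCellLawUpperSomeSectorSplit
import HarnessLib

/-!
# K2R `RealisedQuasiStaticCellLaw`, line `floquet-bloch`, stub `stub_upperSome`: the principal pair and the fast energy
# of the sector truncation over one full slot (LOWER law of the slow energy, first-order cone of the fast energy)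

Summits-side helper file (everything proved; no definitions, no named facts; `--supports stmt-AnomalousDissipation-20446`).
Sector-level form of `outOfPlane_slot_lower` / `inPlane_slot_lower` / `outOfPlane_slot_cone` for the principal coset
`ℓ + ℤK_j` of the sector label `ℓ` itself (`2|ℓ| ≤ n`), slot `[a, b] = [pP + start j, pP + start j + τ_j]`. With
`A(t)² = ‖α_N(t)(ℓ)‖²`, `E(t) = Σ_{k∈freqBall N}‖α_N(t)(k)‖²` (non-increasing, `totalEnergy_antitone`) and the FAST energy
`R(t) = E(t) − 2A(t)²` (everything off the principal pair `±ℓ`):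
* slow LOWER law: `A(t)² ≥ θ_o‖⟪ζ_j, α_N(a)(ℓ)⟫‖² + θ_i‖⟪π_j, α_N(a)(ℓ)⟫‖² − (β/2)R(a)` for every `t ∈ [a, b]`, the two
  block factors `θ_pol = exp(−2Λτ_j(d₀ + (1+ε)σ_pol g₁²(1−4ρ/3)) − slack_pol)` weighting the out-of-plane / in-plane parts
  of the slow vector at the START of the slot (`A(a)² = ‖⟪ζ_j,·⟫‖² + ‖⟪π_j,·⟫‖²`, `slow_frame_split`);
* fast cone: `R(b) ≤ max(e^{−ΛΔτ_j}, e^{−8π²κ(n/2)²τ_j})·R(a) + (2g₁²(2+γ_i²)/Δ²)·E(a)` and, inside the slot, the fast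
  energy of the principal coset is at most `R(a)/2 + (g₁²(2+γ_i²)/Δ²)E(a)`.
These are the per-slot inputs of the scalar slow/fast recursion of the `stub_upperSome` lane (energy LOWER bound for single
long-wave modes; not anomalous dissipation).
-/

set_option linter.dupNamespace false -- layout D-0017: `AnomalousDissipation.AnomalousDissipation` repeats by design

noncomputable section

namespace Summit.AnomalousDissipation.AnomalousDissipation.Theorems.SolenoidalFractalHomogenisation.RealisedQuasiStaticCellLaw

open Set MeasureTheory Filter Topology Function Complex Matrix
open scoped InnerProductSpace ComplexConjugate Matrix BigOperators
open Literature.Analysis Literature.Analysis.FunctionSpaces Literature.Analysis.FunctionSpaces.Torus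
open Literature.Analysis.FluidPDE Literature.Analysis.FluidPDE.LatticeShear
open Summit.AnomalousDissipation.AnomalousDissipation.Theorems.SolenoidalFractalHomogenisation.PermissibleCarrier

variable {k₀ : ℕ}

set_option maxHeartbeats 400000 in -- two block laws + sector bookkeeping in one statement
/-- **Principal pair of the sector truncation over one full slot: frame split, slow LOWER law, energy monotone.** In the
setting of `slavedSector_slot_contraction` (principal coset of the sector label `ℓ`, `2|ℓ| ≤ n`, frames `ζ`,
`p_J = |k_J|⁻¹k_J × ζ`, segment `Wset ∋ 0, ±1`, gap `Δ`, weights `β, ε`, second-order weights `σ_o`, `σ_i`, in-plane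
`γ² = s₀² + s₋₁²`, peak coupling `g₁`) with the weak-coupling hypotheses of the LOWER functional: writing
`A(t)² = ‖α_N(t)(ℓ)‖²`, `E(t) = Σ_{k∈freqBall N}‖α_N(t)(k)‖²`, `R(t) = E(t) − 2A(t)²`, `[a, b]` the slot,
(i) `A(t)² = ‖⟪ζ,α_N(t)(ℓ)⟫‖² + ‖⟪p₀,α_N(t)(ℓ)⟫‖²` for all `t`;
(ii) `θ_o‖⟪ζ,α_N(a)(ℓ)⟫‖² + θ_i‖⟪p₀,α_N(a)(ℓ)⟫‖² − (β/2)R(a) ≤ A(t)²` for `t ∈ [a, b]`,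
`θ_pol = exp(−2Λτ_j(d₀ + (1+ε)σ_pol g₁²(1−4ρ/3)) − slack_pol)`;
(iii) `E(t) ≤ E(a)` for `t ∈ [a, b]`. -/
theorem sector_slot_lower (W : LatticeWord k₀) {n : ℕ} (hn : 0 < n) {κ : ℝ} (hκ : 0 < κ)
    (ℓ : Fin 3 → ℤ) {w₀ : UnitAddTorus (Fin 3) → EuclideanSpace ℝ (Fin 3)}
    (hw₀ : FunctionSpaces.Torus.MemSobolev 1 (FunctionSpaces.EuclideanSpace.complexify ∘ w₀))
    (hdiv : FunctionSpaces.Torus.IsWeaklyDivFree w₀) (hmean : FunctionSpaces.Torus.HasZeroMean w₀)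
    (hsupp : ∀ k : Fin 3 → ℤ, ¬ ((∃ z : Fin 3 → ℤ, k = ℓ + (n:ℤ) • z) ∨ (∃ z : Fin 3 → ℤ, k = -ℓ + (n:ℤ) • z)) →
      UnitAddTorus.mFourierCoeff (FunctionSpaces.EuclideanSpace.complexify ∘ w₀) k = 0)
    {N : ℕ} (hBN : (Finset.univ.biUnion fun j : Fin k₀ =>
        ({(fun i => (W.phase j).m i * n), -(fun i => (W.phase j).m i * n)} : Finset (Fin 3 → ℤ))) ⊆ freqBall N)
    {T : ℝ} (p : ℕ) (j : Fin k₀) (hT : (p : ℝ) * W.period + W.start j + (W.phase j).τ ≤ T)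
    (hk : ∀ J : ℤ, ℓ + J • (fun i => (W.phase j).m i * (n : ℤ)) ∈ freqBall N → ℓ + J • (fun i => (W.phase j).m i * (n : ℤ)) ≠ 0)
    (hdisj : ∀ J J' : ℤ, ℓ + J • (fun i => (W.phase j).m i * (n : ℤ)) ≠ -(ℓ + J' • (fun i => (W.phase j).m i * (n : ℤ))))
    {ζr : Fin 3 → ℝ} (hζ1 : ζr ⬝ᵥ ζr = 1) (hζ0 : ζr ⬝ᵥ (fun i => ((ℓ i : ℤ) : ℝ)) = 0)
    (hζK : ζr ⬝ᵥ (fun i => (((fun i => (W.phase j).m i * (n : ℤ)) i : ℤ) : ℝ)) = 0)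
    {pf : ℤ → Fin 3 → ℝ}
    (hp : ∀ J : ℤ, pf J = (Real.sqrt ((fun i => (((ℓ + J • (fun i => (W.phase j).m i * (n : ℤ))) i : ℤ) : ℝ)) ⬝ᵥ
        (fun i => (((ℓ + J • (fun i => (W.phase j).m i * (n : ℤ))) i : ℤ) : ℝ))))⁻¹ • (fun i => (((ℓ + J • (fun i => (W.phase j).m i * (n : ℤ))) i : ℤ) : ℝ)) ⨯₃ ζr)
    {Wset : Finset ℤ} (hW : ∀ J : ℤ, J ∈ Wset ↔ ℓ + J • (fun i => (W.phase j).m i * (n : ℤ)) ∈ freqBall N)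
    (h0 : (0 : ℤ) ∈ Wset) (h1 : (1 : ℤ) ∈ Wset) (hm1 : (-1 : ℤ) ∈ Wset)
    (hs : ∀ J ∈ Wset, |pf J ⬝ᵥ pf (J + 1)| ≤ 1)
    (Λ Δ ε β σo σi g₁ γ : ℝ) (hΛ : Λ = κ * (4 * Real.pi ^ 2 * freqNormSq (fun i => (W.phase j).m i * (n : ℤ))))
    (hΔ0 : 0 < Δ) (hε : 0 ≤ ε) (hβ : 0 ≤ β)
    (hgap : ∀ J ∈ Wset, J ≠ 0 → freqNormSq ℓ / freqNormSq (fun i => (W.phase j).m i * (n : ℤ)) + Δ ≤ freqNormSq (ℓ + J • (fun i => (W.phase j).m i * (n : ℤ))) / freqNormSq (fun i => (W.phase j).m i * (n : ℤ)))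
    (hσo : σo = 1 / (freqNormSq (ℓ + (-1 : ℤ) • (fun i => (W.phase j).m i * (n : ℤ))) / freqNormSq (fun i => (W.phase j).m i * (n : ℤ)) - freqNormSq ℓ / freqNormSq (fun i => (W.phase j).m i * (n : ℤ))) +
        1 / (freqNormSq (ℓ + (1 : ℤ) • (fun i => (W.phase j).m i * (n : ℤ))) / freqNormSq (fun i => (W.phase j).m i * (n : ℤ)) - freqNormSq ℓ / freqNormSq (fun i => (W.phase j).m i * (n : ℤ))))
    (hσi : σi = (pf (-1) ⬝ᵥ pf 0) ^ 2 / (freqNormSq (ℓ + (-1 : ℤ) • (fun i => (W.phase j).m i * (n : ℤ))) / freqNormSq (fun i => (W.phase j).m i * (n : ℤ)) - freqNormSq ℓ / freqNormSq (fun i => (W.phase j).m i * (n : ℤ))) +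
        (pf 0 ⬝ᵥ pf 1) ^ 2 / (freqNormSq (ℓ + (1 : ℤ) • (fun i => (W.phase j).m i * (n : ℤ))) / freqNormSq (fun i => (W.phase j).m i * (n : ℤ)) - freqNormSq ℓ / freqNormSq (fun i => (W.phase j).m i * (n : ℤ))))
    (hγ : γ ^ 2 = (pf 0 ⬝ᵥ pf 1) ^ 2 + (pf (-1) ⬝ᵥ pf 0) ^ 2) (hγ0 : 0 ≤ γ)
    (hg₁ : g₁ = 2 * Real.pi * (∑ i, (W.phase j).e i * (ℓ i : ℝ)) *
        ‖Complex.exp ((W.phase j).φ * Complex.I) *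
          (1 / (2 * ((2 * Real.pi * ‖latticeVec (W.phase j).m‖ : ℝ) : ℂ) * Complex.I))‖ * (1 / (n : ℝ)) / Λ)
    (hβo : 2 ≤ β * Δ * ε * σo) (hβi : γ ^ 2 ≤ β * Δ * ε * σi)
    (hsmallo : g₁ ^ 2 * (4 * 2 / Δ + 2 * (1 + ε) * σo) +
      2 * (4 * β * 2 * (Λ * |g₁| ^ 3 * σo + |g₁| / (W.ramp * (W.phase j).τ) + Λ * |g₁| ^ 2) ^ 2 / (Λ * Δ ^ 3)) / Λ ≤ Δ)
    (hsmalli : g₁ ^ 2 * (4 * γ ^ 2 / Δ + 2 * (1 + ε) * σi) +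
      2 * (4 * β * γ ^ 2 * (Λ * |g₁| ^ 3 * σi + |g₁| / (W.ramp * (W.phase j).τ) + Λ * |g₁| ^ 2) ^ 2 / (Λ * Δ ^ 3)) / Λ
        ≤ Δ) :
    (∀ t, ‖(pvSetup_cell W hn hκ.le ℓ hw₀ hdiv hmean hsupp).galerkinCoeffAt N t ℓ‖ ^ 2 =
        ‖inner ℂ (WithLp.toLp 2 (Complex.ofReal ∘ ζr) : EuclideanSpace ℂ (Fin 3)) ((pvSetup_cell W hn hκ.le ℓ hw₀ hdiv hmean hsupp).galerkinCoeffAt N t ℓ)‖ ^ 2 + ‖inner ℂ (WithLp.toLp 2 (Complex.ofReal ∘ pf 0) : EuclideanSpace ℂ (Fin 3)) ((pvSetup_cell W hn hκ.le ℓ hw₀ hdiv hmean hsupp).galerkinCoeffAt N t ℓ)‖ ^ 2) ∧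
    (∀ t ∈ Icc ((p : ℝ) * W.period + W.start j) ((p : ℝ) * W.period + W.start j + (W.phase j).τ),
      Real.exp (-(2 * Λ * (W.phase j).τ * (freqNormSq ℓ / freqNormSq (fun i => (W.phase j).m i * (n : ℤ)) +
              (1 + ε) * σo * (g₁ ^ 2 * (1 - 4 * W.ramp / 3))) +
            40 * β * 2 * Λ * (W.phase j).τ * g₁ ^ 4 * (1 + g₁ ^ 2 * σo ^ 2) / Δ ^ 3 +
            48 * β * 2 * g₁ ^ 2 / (W.ramp * (W.phase j).τ * Λ * Δ ^ 3))) *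
          ‖inner ℂ (WithLp.toLp 2 (Complex.ofReal ∘ ζr) : EuclideanSpace ℂ (Fin 3)) ((pvSetup_cell W hn hκ.le ℓ hw₀ hdiv hmean hsupp).galerkinCoeffAt N ((p : ℝ) * W.period + W.start j) ℓ)‖ ^ 2 +
        Real.exp (-(2 * Λ * (W.phase j).τ * (freqNormSq ℓ / freqNormSq (fun i => (W.phase j).m i * (n : ℤ)) +
              (1 + ε) * σi * (g₁ ^ 2 * (1 - 4 * W.ramp / 3))) +
            40 * β * γ ^ 2 * Λ * (W.phase j).τ * g₁ ^ 4 * (1 + g₁ ^ 2 * σi ^ 2) / Δ ^ 3 +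
            48 * β * γ ^ 2 * g₁ ^ 2 / (W.ramp * (W.phase j).τ * Λ * Δ ^ 3))) *
          ‖inner ℂ (WithLp.toLp 2 (Complex.ofReal ∘ pf 0) : EuclideanSpace ℂ (Fin 3)) ((pvSetup_cell W hn hκ.le ℓ hw₀ hdiv hmean hsupp).galerkinCoeffAt N ((p : ℝ) * W.period + W.start j) ℓ)‖ ^ 2 -
        β / 2 * (∑ k ∈ freqBall N, ‖(pvSetup_cell W hn hκ.le ℓ hw₀ hdiv hmean hsupp).galerkinCoeffAt N ((p : ℝ) * W.period + W.start j) k‖ ^ 2 - 2 * ‖(pvSetup_cell W hn hκ.le ℓ hw₀ hdiv hmean hsupp).galerkinCoeffAt N ((p : ℝ) * W.period + W.start j) ℓ‖ ^ 2) ≤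
      ‖(pvSetup_cell W hn hκ.le ℓ hw₀ hdiv hmean hsupp).galerkinCoeffAt N t ℓ‖ ^ 2) ∧
    (∀ t ∈ Icc ((p : ℝ) * W.period + W.start j) ((p : ℝ) * W.period + W.start j + (W.phase j).τ),
      ∑ k ∈ freqBall N, ‖(pvSetup_cell W hn hκ.le ℓ hw₀ hdiv hmean hsupp).galerkinCoeffAt N t k‖ ^ 2 ≤ ∑ k ∈ freqBall N, ‖(pvSetup_cell W hn hκ.le ℓ hw₀ hdiv hmean hsupp).galerkinCoeffAt N ((p : ℝ) * W.period + W.start j) k‖ ^ 2) := by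
  classical
  set hPV := pvSetup_cell W hn hκ.le ℓ hw₀ hdiv hmean hsupp with hPVdef
  set K : Fin 3 → ℤ := (fun i => (W.phase j).m i * (n : ℤ)) with hK
  set ζc : EuclideanSpace ℂ (Fin 3) := WithLp.toLp 2 (Complex.ofReal ∘ ζr) with hζc
  set pc : ℤ → EuclideanSpace ℂ (Fin 3) := fun J => WithLp.toLp 2 (Complex.ofReal ∘ pf J) with hpc
  have hτ : 0 < (W.phase j).τ := (W.phase j).τ_pos
  have hP : 0 < W.period := period_pos W
  have ha0 : 0 ≤ (p : ℝ) * W.period + W.start j := by have := start_nonneg W j; positivity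
  -- complex transversality of `ζ`
  have hcast : ∀ k : Fin 3 → ℤ, ζr ⬝ᵥ (fun i => ((k i : ℤ) : ℝ)) = 0 → ∑ i, ((k i : ℤ) : ℂ) * ζc i = 0 := by
    intro k hk0
    have e : ∑ i, ((k i : ℤ) : ℂ) * ζc i = (((ζr ⬝ᵥ fun i => ((k i : ℤ) : ℝ) : ℝ)) : ℂ) := by
      rw [dotProduct]; push_cast
      refine Finset.sum_congr rfl fun i _ => ?_
      simp [hζc, mul_comm]
    rw [e, hk0]; simp
  -- energies
  set E : ℝ → (Fin 3 → ℤ) → ℝ := fun τ k => ‖hPV.galerkinCoeffAt N τ k‖ ^ 2 with hE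
  have hE0 : ∀ τ k, 0 ≤ E τ k := fun τ k => by positivity
  set Eo : ℝ → ℤ → ℝ := fun τ J => ‖inner ℂ ζc (hPV.galerkinCoeffAt N τ (ℓ + J • K))‖ ^ 2 with hEo
  set Ei : ℝ → ℤ → ℝ := fun τ J => ‖inner ℂ (pc J) (hPV.galerkinCoeffAt N τ (ℓ + J • K))‖ ^ 2 with hEi
  have hEo0 : ∀ τ J, 0 ≤ Eo τ J := fun τ J => by simp only [hEo]; positivity
  have hEi0 : ∀ τ J, 0 ≤ Ei τ J := fun τ J => by simp only [hEi]; positivity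
  set F : Finset (Fin 3 → ℤ) := freqBall N \ (Wset.image (fun J : ℤ => ℓ + J • K) ∪
    (Wset.image (fun J : ℤ => ℓ + J • K)).image (fun k => -k)) with hF
  have hEF0 : ∀ τ, 0 ≤ ∑ k ∈ F, E τ k := fun τ => Finset.sum_nonneg fun k _ => hE0 τ k
  have hZo0 : ∀ τ, 0 ≤ ∑ J ∈ Wset.erase 0, Eo τ J := fun τ => Finset.sum_nonneg fun J _ => hEo0 τ J
  have hZi0 : ∀ τ, 0 ≤ ∑ J ∈ Wset.erase 0, Ei τ J := fun τ => Finset.sum_nonneg fun J _ => hEi0 τ J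
  -- the slot-form split of the fast energy
  have hR : ∀ τ, ∑ k ∈ freqBall N, E τ k - 2 * E τ ℓ =
      2 * ∑ J ∈ Wset.erase 0, (Eo τ J + Ei τ J) + ∑ k ∈ F, E τ k := by
    intro τ
    have h := (sector_fast_split W hn hκ.le ℓ hw₀ hdiv hmean hsupp N j hk hdisj hζ1 hζ0 hζK hp hW h0 τ).1
    simpa only [hE, hEo, hEi, hpc, hζc, hF, hK] using h
  have hsplit0 : ∀ τ, E τ ℓ = Eo τ 0 + Ei τ 0 := by
    intro τ
    have h := (sector_fast_split W hn hκ.le ℓ hw₀ hdiv hmean hsupp N j hk hdisj hζ1 hζ0 hζK hp hW h0 τ).2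
    simpa only [hE, hEo, hEi, hpc, hζc, hK, zero_smul, add_zero] using h
  have hZsum : ∀ τ, ∑ J ∈ Wset.erase 0, (Eo τ J + Ei τ J) = ∑ J ∈ Wset.erase 0, Eo τ J + ∑ J ∈ Wset.erase 0, Ei τ J :=
    fun τ => Finset.sum_add_distrib
  -- energy is non-increasing on the slot; the slow components are bounded by `V = √E(a)`
  have hEmono : ∀ t ∈ Icc ((p : ℝ) * W.period + W.start j) ((p : ℝ) * W.period + W.start j + (W.phase j).τ), ∑ k ∈ freqBall N, E t k ≤ ∑ k ∈ freqBall N, E ((p : ℝ) * W.period + W.start j) k := fun t ht =>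
    totalEnergy_antitone W hn hκ.le ℓ hw₀ hdiv hmean hsupp N ha0 ht.1
  set V : ℝ := Real.sqrt (∑ k ∈ freqBall N, E ((p : ℝ) * W.period + W.start j) k) with hV
  have hV0 : 0 ≤ V := Real.sqrt_nonneg _
  have hVsq : V ^ 2 = ∑ k ∈ freqBall N, E ((p : ℝ) * W.period + W.start j) k := Real.sq_sqrt (Finset.sum_nonneg fun k _ => hE0 _ k)
  have hAle : ∀ t ∈ Icc ((p : ℝ) * W.period + W.start j) ((p : ℝ) * W.period + W.start j + (W.phase j).τ), ‖hPV.galerkinCoeffAt N t ℓ‖ ≤ V := by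
    intro t ht
    rw [hV]
    refine Real.le_sqrt_of_sq_le ?_
    have hℓS : ℓ ∈ freqBall N := by have := (hW 0).1 h0; simpa using this
    exact (Finset.single_le_sum (f := fun k => E t k) (fun k _ => hE0 t k) hℓS).trans (hEmono t ht)
  have hVo : ∀ t ∈ Icc ((p : ℝ) * W.period + W.start j) ((p : ℝ) * W.period + W.start j + (W.phase j).τ), ‖inner ℂ ζc (hPV.galerkinCoeffAt N t ℓ)‖ ≤ V := fun t ht =>
    (norm_inner_toLp_ofReal_le (le_of_eq hζ1) _).trans (hAle t ht)
  have hVi : ∀ t ∈ Icc ((p : ℝ) * W.period + W.start j) ((p : ℝ) * W.period + W.start j + (W.phase j).τ), ‖inner ℂ (pc 0) (hPV.galerkinCoeffAt N t ℓ)‖ ≤ V := by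
    intro t ht
    have hp0 : pf 0 ⬝ᵥ pf 0 ≤ 1 := by
      rw [hp 0]
      exact inPlane_dot_self_le_one _ hζ1 (zeta_dot_coset hζ0 hζK 0)
    exact (norm_inner_toLp_ofReal_le hp0 _).trans (hAle t ht)
  -- the two block lower laws
  have hout := (outOfPlane_slot_lower W hn hκ ℓ hw₀ hdiv hmean hsupp hBN p j hT ℓ (hcast ℓ hζ0) (hcast _ hζK)
    hW h0 h1 hm1 Λ Δ ε β σo g₁ hΛ hΔ0 hε hβ hgap hσo hg₁ hβo hsmallo).2
  obtain ⟨-, hin, -⟩ := inPlane_slot_lower W hn hκ ℓ hw₀ hdiv hmean hsupp hBN p j hT ℓ hk hζ1 hζ0 hζK hp hW h0 h1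
    hm1 hs Λ Δ ε β σi g₁ γ V hΛ hΔ0 hε hβ hgap hσi hγ hγ0 hg₁ hβi hsmalli hV0 hVi
  obtain ⟨θo, hθo⟩ : ∃ θ : ℝ, θ = Real.exp (-(2 * Λ * (W.phase j).τ * (freqNormSq ℓ / freqNormSq K +
              (1 + ε) * σo * (g₁ ^ 2 * (1 - 4 * W.ramp / 3))) +
            40 * β * 2 * Λ * (W.phase j).τ * g₁ ^ 4 * (1 + g₁ ^ 2 * σo ^ 2) / Δ ^ 3 +
            48 * β * 2 * g₁ ^ 2 / (W.ramp * (W.phase j).τ * Λ * Δ ^ 3))) := ⟨_, rfl⟩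
  obtain ⟨θi, hθi⟩ : ∃ θ : ℝ, θ = Real.exp (-(2 * Λ * (W.phase j).τ * (freqNormSq ℓ / freqNormSq K +
              (1 + ε) * σi * (g₁ ^ 2 * (1 - 4 * W.ramp / 3))) +
            40 * β * γ ^ 2 * Λ * (W.phase j).τ * g₁ ^ 4 * (1 + g₁ ^ 2 * σi ^ 2) / Δ ^ 3 +
            48 * β * γ ^ 2 * g₁ ^ 2 / (W.ramp * (W.phase j).τ * Λ * Δ ^ 3))) := ⟨_, rfl⟩
  rw [← hθo] at hout
  rw [← hθi] at hin
  have hout' : ∀ t ∈ Icc ((p : ℝ) * W.period + W.start j) ((p : ℝ) * W.period + W.start j + (W.phase j).τ), θo * Eo ((p : ℝ) * W.period + W.start j) 0 - β * ∑ J ∈ Wset.erase 0, Eo ((p : ℝ) * W.period + W.start j) J ≤ Eo t 0 := by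
    intro t ht; simpa only [hEo, zero_smul, add_zero] using hout t ht
  have hin' : ∀ t ∈ Icc ((p : ℝ) * W.period + W.start j) ((p : ℝ) * W.period + W.start j + (W.phase j).τ), θi * Ei ((p : ℝ) * W.period + W.start j) 0 - β * ∑ J ∈ Wset.erase 0, Ei ((p : ℝ) * W.period + W.start j) J ≤ Ei t 0 := by
    intro t ht; simpa only [hEi, hpc, zero_smul, add_zero] using hin t ht
  refine ⟨fun t => by simpa only [hE, hEo, hEi, hpc, zero_smul, add_zero] using hsplit0 t, fun t ht => ?_,
    fun t ht => by simpa only [hE] using hEmono t ht⟩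
  rw [← hθo, ← hθi]
  have h := add_le_add (hout' t ht) (hin' t ht)
  have key : θo * Eo ((p : ℝ) * W.period + W.start j) 0 + θi * Ei ((p : ℝ) * W.period + W.start j) 0 -
      β / 2 * (∑ k ∈ freqBall N, E ((p : ℝ) * W.period + W.start j) k - 2 * E ((p : ℝ) * W.period + W.start j) ℓ) ≤ E t ℓ := by
    rw [hR, hZsum, hsplit0 t]
    have := mul_nonneg hβ (hEF0 ((p : ℝ) * W.period + W.start j))
    linarith [h, this]
  simpa only [hE, hEo, hEi, hpc, zero_smul, add_zero] using key

set_option maxHeartbeats 400000 in -- two cones + rest block + sector bookkeeping in one statement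
/-- **Fast energy of the sector truncation over one full slot: the first-order cone.** Same setting as
`sector_slot_lower`; with `E`, `R` as there,
(i) `R(b) ≤ max(e^{−ΛΔτ_j}, e^{−8π²κ(n/2)²τ_j})·R(a) + (2g₁²(2+γ²)/Δ²)E(a)`;
(ii) for `t ∈ [a, b]`, the fast energy of the principal coset, `Σ_{J≠0}(‖⟪ζ,α_N(t)(k_J)⟫‖² + ‖⟪p_J,α_N(t)(k_J)⟫‖²)`, is at
most `R(a)/2 + (g₁²(2+γ²)/Δ²)E(a)`. -/
theorem sector_slot_cone (W : LatticeWord k₀) {n : ℕ} (hn : 0 < n) {κ : ℝ} (hκ : 0 < κ)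
    (ℓ : Fin 3 → ℤ) (hℓn : 2 * ‖latticeVec ℓ‖ ≤ n) {w₀ : UnitAddTorus (Fin 3) → EuclideanSpace ℝ (Fin 3)}
    (hw₀ : FunctionSpaces.Torus.MemSobolev 1 (FunctionSpaces.EuclideanSpace.complexify ∘ w₀))
    (hdiv : FunctionSpaces.Torus.IsWeaklyDivFree w₀) (hmean : FunctionSpaces.Torus.HasZeroMean w₀)
    (hsupp : ∀ k : Fin 3 → ℤ, ¬ ((∃ z : Fin 3 → ℤ, k = ℓ + (n:ℤ) • z) ∨ (∃ z : Fin 3 → ℤ, k = -ℓ + (n:ℤ) • z)) →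
      UnitAddTorus.mFourierCoeff (FunctionSpaces.EuclideanSpace.complexify ∘ w₀) k = 0)
    {N : ℕ} (hBN : (Finset.univ.biUnion fun j : Fin k₀ =>
        ({(fun i => (W.phase j).m i * n), -(fun i => (W.phase j).m i * n)} : Finset (Fin 3 → ℤ))) ⊆ freqBall N)
    {T : ℝ} (p : ℕ) (j : Fin k₀) (hT : (p : ℝ) * W.period + W.start j + (W.phase j).τ ≤ T)
    (hk : ∀ J : ℤ, ℓ + J • (fun i => (W.phase j).m i * (n : ℤ)) ∈ freqBall N → ℓ + J • (fun i => (W.phase j).m i * (n : ℤ)) ≠ 0)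
    (hdisj : ∀ J J' : ℤ, ℓ + J • (fun i => (W.phase j).m i * (n : ℤ)) ≠ -(ℓ + J' • (fun i => (W.phase j).m i * (n : ℤ))))
    {ζr : Fin 3 → ℝ} (hζ1 : ζr ⬝ᵥ ζr = 1) (hζ0 : ζr ⬝ᵥ (fun i => ((ℓ i : ℤ) : ℝ)) = 0)
    (hζK : ζr ⬝ᵥ (fun i => (((fun i => (W.phase j).m i * (n : ℤ)) i : ℤ) : ℝ)) = 0)
    {pf : ℤ → Fin 3 → ℝ}
    (hp : ∀ J : ℤ, pf J = (Real.sqrt ((fun i => (((ℓ + J • (fun i => (W.phase j).m i * (n : ℤ))) i : ℤ) : ℝ)) ⬝ᵥ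
        (fun i => (((ℓ + J • (fun i => (W.phase j).m i * (n : ℤ))) i : ℤ) : ℝ))))⁻¹ • (fun i => (((ℓ + J • (fun i => (W.phase j).m i * (n : ℤ))) i : ℤ) : ℝ)) ⨯₃ ζr)
    {Wset : Finset ℤ} (hW : ∀ J : ℤ, J ∈ Wset ↔ ℓ + J • (fun i => (W.phase j).m i * (n : ℤ)) ∈ freqBall N)
    (h0 : (0 : ℤ) ∈ Wset) (h1 : (1 : ℤ) ∈ Wset) (hm1 : (-1 : ℤ) ∈ Wset)
    (hs : ∀ J ∈ Wset, |pf J ⬝ᵥ pf (J + 1)| ≤ 1)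
    (Λ Δ ε β σo σi g₁ γ : ℝ) (hΛ : Λ = κ * (4 * Real.pi ^ 2 * freqNormSq (fun i => (W.phase j).m i * (n : ℤ))))
    (hΔ0 : 0 < Δ) (hε : 0 ≤ ε) (hβ : 0 ≤ β)
    (hgap : ∀ J ∈ Wset, J ≠ 0 → freqNormSq ℓ / freqNormSq (fun i => (W.phase j).m i * (n : ℤ)) + Δ ≤ freqNormSq (ℓ + J • (fun i => (W.phase j).m i * (n : ℤ))) / freqNormSq (fun i => (W.phase j).m i * (n : ℤ)))
    (hσo : σo = 1 / (freqNormSq (ℓ + (-1 : ℤ) • (fun i => (W.phase j).m i * (n : ℤ))) / freqNormSq (fun i => (W.phase j).m i * (n : ℤ)) - freqNormSq ℓ / freqNormSq (fun i => (W.phase j).m i * (n : ℤ))) +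
        1 / (freqNormSq (ℓ + (1 : ℤ) • (fun i => (W.phase j).m i * (n : ℤ))) / freqNormSq (fun i => (W.phase j).m i * (n : ℤ)) - freqNormSq ℓ / freqNormSq (fun i => (W.phase j).m i * (n : ℤ))))
    (hσi : σi = (pf (-1) ⬝ᵥ pf 0) ^ 2 / (freqNormSq (ℓ + (-1 : ℤ) • (fun i => (W.phase j).m i * (n : ℤ))) / freqNormSq (fun i => (W.phase j).m i * (n : ℤ)) - freqNormSq ℓ / freqNormSq (fun i => (W.phase j).m i * (n : ℤ))) +
        (pf 0 ⬝ᵥ pf 1) ^ 2 / (freqNormSq (ℓ + (1 : ℤ) • (fun i => (W.phase j).m i * (n : ℤ))) / freqNormSq (fun i => (W.phase j).m i * (n : ℤ)) - freqNormSq ℓ / freqNormSq (fun i => (W.phase j).m i * (n : ℤ))))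
    (hγ : γ ^ 2 = (pf 0 ⬝ᵥ pf 1) ^ 2 + (pf (-1) ⬝ᵥ pf 0) ^ 2) (hγ0 : 0 ≤ γ)
    (hg₁ : g₁ = 2 * Real.pi * (∑ i, (W.phase j).e i * (ℓ i : ℝ)) *
        ‖Complex.exp ((W.phase j).φ * Complex.I) *
          (1 / (2 * ((2 * Real.pi * ‖latticeVec (W.phase j).m‖ : ℝ) : ℂ) * Complex.I))‖ * (1 / (n : ℝ)) / Λ)
    (hβo : 2 ≤ β * Δ * ε * σo) (hβi : γ ^ 2 ≤ β * Δ * ε * σi)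
    (hsmallo : g₁ ^ 2 * (4 * 2 / Δ + 2 * (1 + ε) * σo) +
      2 * (4 * β * 2 * (Λ * |g₁| ^ 3 * σo + |g₁| / (W.ramp * (W.phase j).τ) + Λ * |g₁| ^ 2) ^ 2 / (Λ * Δ ^ 3)) / Λ ≤ Δ)
    (hsmalli : g₁ ^ 2 * (4 * γ ^ 2 / Δ + 2 * (1 + ε) * σi) +
      2 * (4 * β * γ ^ 2 * (Λ * |g₁| ^ 3 * σi + |g₁| / (W.ramp * (W.phase j).τ) + Λ * |g₁| ^ 2) ^ 2 / (Λ * Δ ^ 3)) / Λ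
        ≤ Δ) :
    (∑ k ∈ freqBall N, ‖(pvSetup_cell W hn hκ.le ℓ hw₀ hdiv hmean hsupp).galerkinCoeffAt N ((p : ℝ) * W.period + W.start j + (W.phase j).τ) k‖ ^ 2 - 2 * ‖(pvSetup_cell W hn hκ.le ℓ hw₀ hdiv hmean hsupp).galerkinCoeffAt N ((p : ℝ) * W.period + W.start j + (W.phase j).τ) ℓ‖ ^ 2 ≤
      max (Real.exp (-(Λ * Δ) * (W.phase j).τ)) (Real.exp (-(8 * Real.pi ^ 2 * κ * ((n : ℝ) / 2) ^ 2) * (W.phase j).τ)) *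
          (∑ k ∈ freqBall N, ‖(pvSetup_cell W hn hκ.le ℓ hw₀ hdiv hmean hsupp).galerkinCoeffAt N ((p : ℝ) * W.period + W.start j) k‖ ^ 2 - 2 * ‖(pvSetup_cell W hn hκ.le ℓ hw₀ hdiv hmean hsupp).galerkinCoeffAt N ((p : ℝ) * W.period + W.start j) ℓ‖ ^ 2) +
        2 * g₁ ^ 2 * (2 + γ ^ 2) / Δ ^ 2 * ∑ k ∈ freqBall N, ‖(pvSetup_cell W hn hκ.le ℓ hw₀ hdiv hmean hsupp).galerkinCoeffAt N ((p : ℝ) * W.period + W.start j) k‖ ^ 2) ∧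
    (∀ t ∈ Icc ((p : ℝ) * W.period + W.start j) ((p : ℝ) * W.period + W.start j + (W.phase j).τ),
      ∑ J ∈ Wset.erase 0, (‖inner ℂ (WithLp.toLp 2 (Complex.ofReal ∘ ζr) : EuclideanSpace ℂ (Fin 3)) ((pvSetup_cell W hn hκ.le ℓ hw₀ hdiv hmean hsupp).galerkinCoeffAt N t (ℓ + J • (fun i => (W.phase j).m i * (n : ℤ))))‖ ^ 2 +
          ‖inner ℂ (WithLp.toLp 2 (Complex.ofReal ∘ pf J) : EuclideanSpace ℂ (Fin 3)) ((pvSetup_cell W hn hκ.le ℓ hw₀ hdiv hmean hsupp).galerkinCoeffAt N t (ℓ + J • (fun i => (W.phase j).m i * (n : ℤ))))‖ ^ 2) ≤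
        (∑ k ∈ freqBall N, ‖(pvSetup_cell W hn hκ.le ℓ hw₀ hdiv hmean hsupp).galerkinCoeffAt N ((p : ℝ) * W.period + W.start j) k‖ ^ 2 - 2 * ‖(pvSetup_cell W hn hκ.le ℓ hw₀ hdiv hmean hsupp).galerkinCoeffAt N ((p : ℝ) * W.period + W.start j) ℓ‖ ^ 2) / 2 +
          g₁ ^ 2 * (2 + γ ^ 2) / Δ ^ 2 * ∑ k ∈ freqBall N, ‖(pvSetup_cell W hn hκ.le ℓ hw₀ hdiv hmean hsupp).galerkinCoeffAt N ((p : ℝ) * W.period + W.start j) k‖ ^ 2) := by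
  classical
  set hPV := pvSetup_cell W hn hκ.le ℓ hw₀ hdiv hmean hsupp with hPVdef
  set K : Fin 3 → ℤ := (fun i => (W.phase j).m i * (n : ℤ)) with hK
  set ζc : EuclideanSpace ℂ (Fin 3) := WithLp.toLp 2 (Complex.ofReal ∘ ζr) with hζc
  set pc : ℤ → EuclideanSpace ℂ (Fin 3) := fun J => WithLp.toLp 2 (Complex.ofReal ∘ pf J) with hpc
  have hτ : 0 < (W.phase j).τ := (W.phase j).τ_pos
  have hP : 0 < W.period := period_pos W
  have ha0 : 0 ≤ (p : ℝ) * W.period + W.start j := by have := start_nonneg W j; positivity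
  -- complex transversality of `ζ`
  have hcast : ∀ k : Fin 3 → ℤ, ζr ⬝ᵥ (fun i => ((k i : ℤ) : ℝ)) = 0 → ∑ i, ((k i : ℤ) : ℂ) * ζc i = 0 := by
    intro k hk0
    have e : ∑ i, ((k i : ℤ) : ℂ) * ζc i = (((ζr ⬝ᵥ fun i => ((k i : ℤ) : ℝ) : ℝ)) : ℂ) := by
      rw [dotProduct]; push_cast
      refine Finset.sum_congr rfl fun i _ => ?_
      simp [hζc, mul_comm]
    rw [e, hk0]; simp
  -- energies
  set E : ℝ → (Fin 3 → ℤ) → ℝ := fun τ k => ‖hPV.galerkinCoeffAt N τ k‖ ^ 2 with hE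
  have hE0 : ∀ τ k, 0 ≤ E τ k := fun τ k => by positivity
  set Eo : ℝ → ℤ → ℝ := fun τ J => ‖inner ℂ ζc (hPV.galerkinCoeffAt N τ (ℓ + J • K))‖ ^ 2 with hEo
  set Ei : ℝ → ℤ → ℝ := fun τ J => ‖inner ℂ (pc J) (hPV.galerkinCoeffAt N τ (ℓ + J • K))‖ ^ 2 with hEi
  have hEo0 : ∀ τ J, 0 ≤ Eo τ J := fun τ J => by simp only [hEo]; positivity
  have hEi0 : ∀ τ J, 0 ≤ Ei τ J := fun τ J => by simp only [hEi]; positivity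
  set F : Finset (Fin 3 → ℤ) := freqBall N \ (Wset.image (fun J : ℤ => ℓ + J • K) ∪
    (Wset.image (fun J : ℤ => ℓ + J • K)).image (fun k => -k)) with hF
  have hEF0 : ∀ τ, 0 ≤ ∑ k ∈ F, E τ k := fun τ => Finset.sum_nonneg fun k _ => hE0 τ k
  have hZo0 : ∀ τ, 0 ≤ ∑ J ∈ Wset.erase 0, Eo τ J := fun τ => Finset.sum_nonneg fun J _ => hEo0 τ J
  have hZi0 : ∀ τ, 0 ≤ ∑ J ∈ Wset.erase 0, Ei τ J := fun τ => Finset.sum_nonneg fun J _ => hEi0 τ J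
  -- the slot-form split of the fast energy
  have hR : ∀ τ, ∑ k ∈ freqBall N, E τ k - 2 * E τ ℓ =
      2 * ∑ J ∈ Wset.erase 0, (Eo τ J + Ei τ J) + ∑ k ∈ F, E τ k := by
    intro τ
    have h := (sector_fast_split W hn hκ.le ℓ hw₀ hdiv hmean hsupp N j hk hdisj hζ1 hζ0 hζK hp hW h0 τ).1
    simpa only [hE, hEo, hEi, hpc, hζc, hF, hK] using h
  have hsplit0 : ∀ τ, E τ ℓ = Eo τ 0 + Ei τ 0 := by
    intro τ
    have h := (sector_fast_split W hn hκ.le ℓ hw₀ hdiv hmean hsupp N j hk hdisj hζ1 hζ0 hζK hp hW h0 τ).2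
    simpa only [hE, hEo, hEi, hpc, hζc, hK, zero_smul, add_zero] using h
  have hZsum : ∀ τ, ∑ J ∈ Wset.erase 0, (Eo τ J + Ei τ J) = ∑ J ∈ Wset.erase 0, Eo τ J + ∑ J ∈ Wset.erase 0, Ei τ J :=
    fun τ => Finset.sum_add_distrib
  -- energy is non-increasing on the slot; the slow components are bounded by `V = √E(a)`
  have hEmono : ∀ t ∈ Icc ((p : ℝ) * W.period + W.start j) ((p : ℝ) * W.period + W.start j + (W.phase j).τ), ∑ k ∈ freqBall N, E t k ≤ ∑ k ∈ freqBall N, E ((p : ℝ) * W.period + W.start j) k := fun t ht =>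
    totalEnergy_antitone W hn hκ.le ℓ hw₀ hdiv hmean hsupp N ha0 ht.1
  set V : ℝ := Real.sqrt (∑ k ∈ freqBall N, E ((p : ℝ) * W.period + W.start j) k) with hV
  have hV0 : 0 ≤ V := Real.sqrt_nonneg _
  have hVsq : V ^ 2 = ∑ k ∈ freqBall N, E ((p : ℝ) * W.period + W.start j) k := Real.sq_sqrt (Finset.sum_nonneg fun k _ => hE0 _ k)
  have hAle : ∀ t ∈ Icc ((p : ℝ) * W.period + W.start j) ((p : ℝ) * W.period + W.start j + (W.phase j).τ), ‖hPV.galerkinCoeffAt N t ℓ‖ ≤ V := by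
    intro t ht
    rw [hV]
    refine Real.le_sqrt_of_sq_le ?_
    have hℓS : ℓ ∈ freqBall N := by have := (hW 0).1 h0; simpa using this
    exact (Finset.single_le_sum (f := fun k => E t k) (fun k _ => hE0 t k) hℓS).trans (hEmono t ht)
  have hVo : ∀ t ∈ Icc ((p : ℝ) * W.period + W.start j) ((p : ℝ) * W.period + W.start j + (W.phase j).τ), ‖inner ℂ ζc (hPV.galerkinCoeffAt N t ℓ)‖ ≤ V := fun t ht =>
    (norm_inner_toLp_ofReal_le (le_of_eq hζ1) _).trans (hAle t ht)
  have hVi : ∀ t ∈ Icc ((p : ℝ) * W.period + W.start j) ((p : ℝ) * W.period + W.start j + (W.phase j).τ), ‖inner ℂ (pc 0) (hPV.galerkinCoeffAt N t ℓ)‖ ≤ V := by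
    intro t ht
    have hp0 : pf 0 ⬝ᵥ pf 0 ≤ 1 := by
      rw [hp 0]
      exact inPlane_dot_self_le_one _ hζ1 (zeta_dot_coset hζ0 hζK 0)
    exact (norm_inner_toLp_ofReal_le hp0 _).trans (hAle t ht)
  have _ := hε; have _ := hβo; have _ := hβi; have _ := hsmallo; have _ := hsmalli; have _ := hσo
  -- the two cones and the rest-block decay
  have hconeo := outOfPlane_slot_cone W hn hκ ℓ hw₀ hdiv hmean hsupp hBN p j hT ℓ (hcast ℓ hζ0) (hcast _ hζK)
    hW h1 hm1 Λ Δ g₁ V hΛ hΔ0 hgap hg₁ hV0 hVo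
  obtain ⟨-, -, hconei⟩ := inPlane_slot_lower W hn hκ ℓ hw₀ hdiv hmean hsupp hBN p j hT ℓ hk hζ1 hζ0 hζK hp hW h0 h1
    hm1 hs Λ Δ ε β σi g₁ γ V hΛ hΔ0 hε hβ hgap hσi hγ hγ0 hg₁ hβi hsmalli hV0 hVi
  have hFdec' := sector_rest_decay W hn hκ.le ℓ hw₀ hdiv hmean hsupp hℓn hBN p j hT hW
  obtain ⟨θF, hθF⟩ : ∃ θ : ℝ, θ = Real.exp (-(8 * Real.pi ^ 2 * κ * ((n : ℝ) / 2) ^ 2) * (W.phase j).τ) := ⟨_, rfl⟩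
  rw [← hθF] at hFdec'
  have hFdec : ∑ k ∈ F, E ((p : ℝ) * W.period + W.start j + (W.phase j).τ) k ≤ θF * ∑ k ∈ F, E ((p : ℝ) * W.period + W.start j) k := by simpa only [hE, hF, hK] using hFdec'
  have hconeo' : ∀ t ∈ Icc ((p : ℝ) * W.period + W.start j) ((p : ℝ) * W.period + W.start j + (W.phase j).τ), ∑ J ∈ Wset.erase 0, Eo t J ≤
      Real.exp (-(Λ * Δ) * (t - ((p : ℝ) * W.period + W.start j))) * ∑ J ∈ Wset.erase 0, Eo ((p : ℝ) * W.period + W.start j) J + (|g₁| * Real.sqrt 2 * V / Δ) ^ 2 := by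
    intro t ht; simpa only [hEo] using hconeo t ht
  have hconei' : ∀ t ∈ Icc ((p : ℝ) * W.period + W.start j) ((p : ℝ) * W.period + W.start j + (W.phase j).τ), ∑ J ∈ Wset.erase 0, Ei t J ≤
      Real.exp (-(Λ * Δ) * (t - ((p : ℝ) * W.period + W.start j))) * ∑ J ∈ Wset.erase 0, Ei ((p : ℝ) * W.period + W.start j) J + (|g₁| * γ * V / Δ) ^ 2 := by
    intro t ht; simpa only [hEi, hpc] using hconei t ht
  have hsq2 : (|g₁| * Real.sqrt 2 * V / Δ) ^ 2 = 2 * g₁ ^ 2 * V ^ 2 / Δ ^ 2 := by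
    rw [div_pow, mul_pow, mul_pow, sq_abs, Real.sq_sqrt (by norm_num)]; ring
  have hsqγ : (|g₁| * γ * V / Δ) ^ 2 = g₁ ^ 2 * γ ^ 2 * V ^ 2 / Δ ^ 2 := by
    rw [div_pow, mul_pow, mul_pow, sq_abs]
  have hΛ0 : 0 < Λ := by rw [hΛ]; exact cellRate_pos (W.phase j) hn hκ
  refine ⟨?_, fun t ht => ?_⟩
  · -- (i) the fast cone at the end of the slot
    have hb_mem : ((p : ℝ) * W.period + W.start j + (W.phase j).τ) ∈ Icc ((p : ℝ) * W.period + W.start j) ((p : ℝ) * W.period + W.start j + (W.phase j).τ) := ⟨by linarith, le_rfl⟩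
    have ho := hconeo' _ hb_mem
    have hi := hconei' _ hb_mem
    rw [show ((p : ℝ) * W.period + W.start j + (W.phase j).τ) - ((p : ℝ) * W.period + W.start j) = (W.phase j).τ by ring] at ho hi
    obtain ⟨θc, hθc⟩ : ∃ θ : ℝ, θ = Real.exp (-(Λ * Δ) * (W.phase j).τ) := ⟨_, rfl⟩
    rw [← hθc] at ho hi
    rw [← hθc, ← hθF]
    have hmc : θc ≤ max θc θF := le_max_left _ _
    have hmF : θF ≤ max θc θF := le_max_right _ _
    have key : ∑ k ∈ freqBall N, E ((p : ℝ) * W.period + W.start j + (W.phase j).τ) k - 2 * E ((p : ℝ) * W.period + W.start j + (W.phase j).τ) ℓ ≤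
        max θc θF * (∑ k ∈ freqBall N, E ((p : ℝ) * W.period + W.start j) k - 2 * E ((p : ℝ) * W.period + W.start j) ℓ) +
          2 * g₁ ^ 2 * (2 + γ ^ 2) / Δ ^ 2 * ∑ k ∈ freqBall N, E ((p : ℝ) * W.period + W.start j) k := by
      rw [hR, hR, hZsum, hZsum, ← hVsq]
      rw [hsq2] at ho
      rw [hsqγ] at hi
      have t1 := mul_le_mul_of_nonneg_right hmc (hZo0 ((p : ℝ) * W.period + W.start j))
      have t2 := mul_le_mul_of_nonneg_right hmc (hZi0 ((p : ℝ) * W.period + W.start j))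
      have t3 := mul_le_mul_of_nonneg_right hmF (hEF0 ((p : ℝ) * W.period + W.start j))
      have e : 2 * g₁ ^ 2 * (2 + γ ^ 2) / Δ ^ 2 * V ^ 2 = 2 * (2 * g₁ ^ 2 * V ^ 2 / Δ ^ 2) +
          2 * (g₁ ^ 2 * γ ^ 2 * V ^ 2 / Δ ^ 2) := by ring
      linarith [ho, hi, hFdec, t1, t2, t3, e]
    simpa only [hE] using key
  · -- (ii) the interior cone of the principal coset
    have ho := hconeo' t ht
    have hi := hconei' t ht
    have hexp : Real.exp (-(Λ * Δ) * (t - ((p : ℝ) * W.period + W.start j))) ≤ 1 := by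
      rw [← Real.exp_zero]
      refine Real.exp_le_exp.2 ?_
      have : 0 ≤ Λ * Δ * (t - ((p : ℝ) * W.period + W.start j)) := mul_nonneg (mul_nonneg hΛ0.le hΔ0.le) (by linarith [ht.1])
      linarith
    have key : ∑ J ∈ Wset.erase 0, (Eo t J + Ei t J) ≤
        (∑ k ∈ freqBall N, E ((p : ℝ) * W.period + W.start j) k - 2 * E ((p : ℝ) * W.period + W.start j) ℓ) / 2 +
          g₁ ^ 2 * (2 + γ ^ 2) / Δ ^ 2 * ∑ k ∈ freqBall N, E ((p : ℝ) * W.period + W.start j) k := by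
      rw [hR, hZsum, hZsum, ← hVsq]
      rw [hsq2] at ho
      rw [hsqγ] at hi
      have t1 := mul_le_mul_of_nonneg_right hexp (hZo0 ((p : ℝ) * W.period + W.start j))
      have t2 := mul_le_mul_of_nonneg_right hexp (hZi0 ((p : ℝ) * W.period + W.start j))
      have := hEF0 ((p : ℝ) * W.period + W.start j)
      have e : g₁ ^ 2 * (2 + γ ^ 2) / Δ ^ 2 * V ^ 2 = 2 * g₁ ^ 2 * V ^ 2 / Δ ^ 2 + g₁ ^ 2 * γ ^ 2 * V ^ 2 / Δ ^ 2 := by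
        ring
      linarith [ho, hi, t1, t2, this, e]
    simpa only [hEo, hEi, hpc] using key

end Summit.AnomalousDissipation.AnomalousDissipation.Theorems.SolenoidalFractalHomogenisation.RealisedQuasiStaticCellLaw

end
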